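import Summits.ValiantsHypothesis.ValiantsHypothesis.Theorems.LacunarySymmetroidMatrixDescartesPivotRankOneCriticalWindowsParallelTwoCertificate

/-!
# `MatrixDescartes` census — rank-one `(2,K)₁`: THE CHEBYSHEV STEP OF THE PARALLEL TWO-LETTER LAW
# (`x·P + y·Q + z·R`, `z ≠ 0`, has at most two zeros on `(0,∞)` — two Rolle steps on the certificate of `…ParallelTwoCertificate`)

HONEST FRAMING.  Object-search cell `pub-symmetroid`, seat `val-sym-mdr-p1` (generation 25); helper file `--supports` the crux item
stmt-ValiantsHypothesis-18050 (`Theses.LacunarySymmetroid.MatrixDescartes`, OPEN, on HOLD) with NO closure claim.  The analytic half of the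
certificate: since `P > 0`, `W(P,Q) > 0`, `W(P,Q,R) > 0` on `(0,∞)` (`…ParallelTwoCertificate`), the classical extended-Chebyshev argument
(divide by `P`, Rolle, divide by `W(P,Q)`, Rolle, the universal quotient identity) — stated once for ABSTRACT functions (`ect_no_three_zeros`) and instantiated — shows that NO combination `x·P + y·Q + z·R` with `z ≠ 0` has three
distinct zeros in `(0,∞)` (**`no_three_zeros`**).  With `x = b₁b₂`, `y = −a(b₁+b₂)`, `z = a² ≠ 0` this is the zero bound for the numerator of
`H′` in `…ParallelTwoCertificate.num_identity`; the remaining assembly (four critical points ⇒ three zeros of that numerator on the admissible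
interval, via `…ParallelReduction.parallel_eliminant` and the weight-free invariant) is spelled out in the seat memo ROOT-COUNT.md §7 for the
successor.  Nothing here bears on `MatrixDescartes` in its window, on `DoorA26` / `DoorA34`, registers / ζ, or `VP ≠ VNP`.

[folklore] Rolle's theorem (`exists_hasDerivAt_eq_zero`), `HasDerivAt.div`; the certificate file.  No definitions (local notation only), no named facts.
-/

-- `Summit.ValiantsHypothesis.ValiantsHypothesis.…` repeats a component by the D-0017 layout
-- (single-conjunct summit), which the `dupNamespace` linter flags; the name is mandated.
set_option linter.dupNamespace false

namespace Summit.ValiantsHypothesis.ValiantsHypothesis.Theorems.LacunarySymmetroidMatrixDescartes.Pivot.CriticalWindows.ParallelTwo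

open Set

/-- The polynomial `𝐏(c,u)` of the certificate (explicit; local notation, no definition). -/
local notation3 (prettyPrint := false) "𝐏⟦" c ", " u "⟧" => (16 * c ^ (4 : ℕ) + 16 * c ^ (5 : ℕ) + 40 * c ^ (3 : ℕ) * u + 80 * c ^ (4 : ℕ) * u + 40 * c ^ (5 : ℕ) * u + 36 * c ^ (2 : ℕ) * u ^ (2 : ℕ) + 124 * c ^ (3 : ℕ) * u ^ (2 : ℕ) + 124 * c ^ (4 : ℕ) * u ^ (2 : ℕ) + 36 * c ^ (5 : ℕ) * u ^ (2 : ℕ) + 14 * c * u ^ (3 : ℕ) + 80 * c ^ (2 : ℕ) * u ^ (3 : ℕ) + 132 * c ^ (3 : ℕ) * u ^ (3 : ℕ) + 80 * c ^ (4 : ℕ) * u ^ (3 : ℕ) + 14 * c ^ (5 : ℕ) * u ^ (3 : ℕ) + 2 * u ^ (4 : ℕ) + 22 * c * u ^ (4 : ℕ) + 56 * c ^ (2 : ℕ) * u ^ (4 : ℕ) + 56 * c ^ (3 : ℕ) * u ^ (4 : ℕ) + 22 * c ^ (4 : ℕ) * u ^ (4 : ℕ) + 2 * c ^ (5 : ℕ)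 * u ^ (4 : ℕ) + 2 * u ^ (5 : ℕ) + 8 * c * u ^ (5 : ℕ) + 12 * c ^ (2 : ℕ) * u ^ (5 : ℕ) + 8 * c ^ (3 : ℕ) * u ^ (5 : ℕ) + 2 * c ^ (4 : ℕ) * u ^ (5 : ℕ))

/-- The polynomial `𝐐(c,u)` of the certificate (explicit; local notation, no definition). -/
local notation3 (prettyPrint := false) "𝐐⟦" c ", " u "⟧" => (8 * c ^ (3 : ℕ) * u + 16 * c ^ (4 : ℕ) * u + 8 * c ^ (5 : ℕ) * u + 16 * c ^ (2 : ℕ) * u ^ (2 : ℕ) + 64 * c ^ (3 : ℕ) * u ^ (2 : ℕ) + 64 * c ^ (4 : ℕ) * u ^ (2 : ℕ) + 16 * c ^ (5 : ℕ) * u ^ (2 : ℕ) + 10 * c * u ^ (3 : ℕ) + 80 * c ^ (2 : ℕ) * u ^ (3 : ℕ) + 140 * c ^ (3 : ℕ) * u ^ (3 : ℕ) + 80 * c ^ (4 : ℕ) * u ^ (3 : ℕ) + 10 * c ^ (5 : ℕ) * u ^ (3 : ℕ) + 2 * u ^ (4 : ℕ) + 38 * c * u ^ (4 : ℕ) + 120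 * c ^ (2 : ℕ) * u ^ (4 : ℕ) + 120 * c ^ (3 : ℕ) * u ^ (4 : ℕ) + 38 * c ^ (4 : ℕ) * u ^ (4 : ℕ) + 2 * c ^ (5 : ℕ) * u ^ (4 : ℕ) + 6 * u ^ (5 : ℕ) + 40 * c * u ^ (5 : ℕ) + 68 * c ^ (2 : ℕ) * u ^ (5 : ℕ) + 40 * c ^ (3 : ℕ) * u ^ (5 : ℕ) + 6 * c ^ (4 : ℕ) * u ^ (5 : ℕ) + 4 * u ^ (6 : ℕ) + 12 * c * u ^ (6 : ℕ) + 12 * c ^ (2 : ℕ) * u ^ (6 : ℕ) + 4 * c ^ (3 : ℕ) * u ^ (6 : ℕ))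

/-- The polynomial `𝐑(c,u)` of the certificate (explicit; local notation, no definition). -/
local notation3 (prettyPrint := false) "𝐑⟦" c ", " u "⟧" => (8 * c ^ (3 : ℕ) * u + 16 * c ^ (4 : ℕ) * u + 8 * c ^ (5 : ℕ) * u + 16 * c ^ (2 : ℕ) * u ^ (2 : ℕ) + 96 * c ^ (3 : ℕ) * u ^ (2 : ℕ) + 96 * c ^ (4 : ℕ) * u ^ (2 : ℕ) + 16 * c ^ (5 : ℕ) * u ^ (2 : ℕ) + 10 * c * u ^ (3 : ℕ) + 144 * c ^ (2 : ℕ) * u ^ (3 : ℕ) + 332 * c ^ (3 : ℕ) * u ^ (3 : ℕ) + 144 * c ^ (4 : ℕ) * u ^ (3 : ℕ) + 10 * c ^ (5 : ℕ) * u ^ (3 : ℕ) + 2 * u ^ (4 : ℕ) + 78 * c * u ^ (4 : ℕ) + 400 * c ^ (2 : ℕ) * u ^ (4 : ℕ) + 400 * c ^ (3 : ℕ) * u ^ (4 : ℕ) + 78 * c ^ (4 : ℕ) * u ^ (4 : ℕ) + 2 * c ^ (5 : ℕ) * u ^ (4 : ℕ) + 14 * u ^ (5 : ℕ) + 184 *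 c * u ^ (5 : ℕ) + 404 * c ^ (2 : ℕ) * u ^ (5 : ℕ) + 184 * c ^ (3 : ℕ) * u ^ (5 : ℕ) + 14 * c ^ (4 : ℕ) * u ^ (5 : ℕ) + 28 * u ^ (6 : ℕ) + 148 * c * u ^ (6 : ℕ) + 148 * c ^ (2 : ℕ) * u ^ (6 : ℕ) + 28 * c ^ (3 : ℕ) * u ^ (6 : ℕ) + 16 * u ^ (7 : ℕ) + 32 * c * u ^ (7 : ℕ) + 16 * c ^ (2 : ℕ) * u ^ (7 : ℕ))

/-- The polynomial `𝐏₁(c,u)` of the certificate (explicit; local notation, no definition). -/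
local notation3 (prettyPrint := false) "𝐏₁⟦" c ", " u "⟧" => (40 * c ^ (3 : ℕ) + 80 * c ^ (4 : ℕ) + 40 * c ^ (5 : ℕ) + 72 * c ^ (2 : ℕ) * u + 248 * c ^ (3 : ℕ) * u + 248 * c ^ (4 : ℕ) * u + 72 * c ^ (5 : ℕ) * u + 42 * c * u ^ (2 : ℕ) + 240 * c ^ (2 : ℕ) * u ^ (2 : ℕ) + 396 * c ^ (3 : ℕ) * u ^ (2 : ℕ) + 240 * c ^ (4 : ℕ) * u ^ (2 : ℕ) + 42 * c ^ (5 : ℕ) * u ^ (2 : ℕ) + 8 * u ^ (3 : ℕ) + 88 * c * u ^ (3 : ℕ) + 224 * c ^ (2 : ℕ) * u ^ (3 : ℕ) + 224 * c ^ (3 : ℕ) * u ^ (3 : ℕ) + 88 * c ^ (4 : ℕ) * u ^ (3 : ℕ) + 8 * c ^ (5 : ℕ) * u ^ (3 : ℕ) + 10 * u ^ (4 : ℕ) + 40 * c * u ^ (4 : ℕ) + 60 * c ^ (2 : ℕ) * u ^ (4 : ℕ) + 40 * c ^ (3 : ℕ) * u ^ (4 : ℕ) + 10 * c ^ (4 :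 ℕ) * u ^ (4 : ℕ))

/-- The polynomial `𝐐₁(c,u)` of the certificate (explicit; local notation, no definition). -/
local notation3 (prettyPrint := false) "𝐐₁⟦" c ", " u "⟧" => (8 * c ^ (3 : ℕ) + 16 * c ^ (4 : ℕ) + 8 * c ^ (5 : ℕ) + 32 * c ^ (2 : ℕ) * u + 128 * c ^ (3 : ℕ) * u + 128 * c ^ (4 : ℕ) * u + 32 * c ^ (5 : ℕ) * u + 30 * c * u ^ (2 : ℕ) + 240 * c ^ (2 : ℕ) * u ^ (2 : ℕ) + 420 * c ^ (3 : ℕ) * u ^ (2 : ℕ) + 240 * c ^ (4 : ℕ) * u ^ (2 : ℕ) + 30 * c ^ (5 : ℕ) * u ^ (2 : ℕ) + 8 * u ^ (3 : ℕ) + 152 * c * u ^ (3 : ℕ) + 480 * c ^ (2 : ℕ) * u ^ (3 : ℕ) + 480 * c ^ (3 : ℕ) * u ^ (3 : ℕ) + 152 * c ^ (4 : ℕ) * u ^ (3 : ℕ) + 8 * c ^ (5 : ℕ) * u ^ (3 : ℕ) + 30 * u ^ (4 : ℕ) + 200 * c * u ^ (4 : ℕ) + 340 * c ^ (2 : ℕ)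 * u ^ (4 : ℕ) + 200 * c ^ (3 : ℕ) * u ^ (4 : ℕ) + 30 * c ^ (4 : ℕ) * u ^ (4 : ℕ) + 24 * u ^ (5 : ℕ) + 72 * c * u ^ (5 : ℕ) + 72 * c ^ (2 : ℕ) * u ^ (5 : ℕ) + 24 * c ^ (3 : ℕ) * u ^ (5 : ℕ))

/-- The polynomial `𝐑₁(c,u)` of the certificate (explicit; local notation, no definition). -/
local notation3 (prettyPrint := false) "𝐑₁⟦" c ", " u "⟧" => (8 * c ^ (3 : ℕ) + 16 * c ^ (4 : ℕ) + 8 * c ^ (5 : ℕ) + 32 * c ^ (2 : ℕ) * u + 192 * c ^ (3 : ℕ) * u + 192 * c ^ (4 : ℕ) * u + 32 * c ^ (5 : ℕ) * u + 30 * c * u ^ (2 : ℕ) + 432 * c ^ (2 : ℕ) * u ^ (2 : ℕ) + 996 * c ^ (3 : ℕ) * u ^ (2 : ℕ) + 432 * c ^ (4 : ℕ) * u ^ (2 : ℕ) + 30 * c ^ (5 : ℕ) * u ^ (2 : ℕ) + 8 * u ^ (3 : ℕ) + 312 * c * u ^ (3 : ℕ) + 1600 * c ^ (2 : ℕ) *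 u ^ (3 : ℕ) + 1600 * c ^ (3 : ℕ) * u ^ (3 : ℕ) + 312 * c ^ (4 : ℕ) * u ^ (3 : ℕ) + 8 * c ^ (5 : ℕ) * u ^ (3 : ℕ) + 70 * u ^ (4 : ℕ) + 920 * c * u ^ (4 : ℕ) + 2020 * c ^ (2 : ℕ) * u ^ (4 : ℕ) + 920 * c ^ (3 : ℕ) * u ^ (4 : ℕ) + 70 * c ^ (4 : ℕ) * u ^ (4 : ℕ) + 168 * u ^ (5 : ℕ) + 888 * c * u ^ (5 : ℕ) + 888 * c ^ (2 : ℕ) * u ^ (5 : ℕ) + 168 * c ^ (3 : ℕ) * u ^ (5 : ℕ) + 112 * u ^ (6 : ℕ) + 224 * c * u ^ (6 : ℕ) + 112 * c ^ (2 : ℕ) * u ^ (6 : ℕ))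

/-- The polynomial `𝐏₂(c,u)` of the certificate (explicit; local notation, no definition). -/
local notation3 (prettyPrint := false) "𝐏₂⟦" c ", " u "⟧" => (72 * c ^ (2 : ℕ) + 248 * c ^ (3 : ℕ) + 248 * c ^ (4 : ℕ) + 72 * c ^ (5 : ℕ) + 84 * c * u + 480 * c ^ (2 : ℕ) * u + 792 * c ^ (3 : ℕ) * u + 480 * c ^ (4 : ℕ) * u + 84 * c ^ (5 : ℕ) * u + 24 * u ^ (2 : ℕ) + 264 * c * u ^ (2 : ℕ) + 672 * c ^ (2 : ℕ) * u ^ (2 : ℕ) + 672 * c ^ (3 : ℕ) * u ^ (2 : ℕ) + 264 * c ^ (4 : ℕ) * u ^ (2 : ℕ) + 24 * c ^ (5 : ℕ) * u ^ (2 : ℕ) + 40 * u ^ (3 : ℕ) + 160 * c * u ^ (3 : ℕ) + 240 * c ^ (2 : ℕ) * u ^ (3 : ℕ) + 160 * c ^ (3 : ℕ) * u ^ (3 : ℕ) + 40 * c ^ (4 : ℕ) * u ^ (3 : ℕ))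

/-- The polynomial `𝐐₂(c,u)` of the certificate (explicit; local notation, no definition). -/
local notation3 (prettyPrint := false) "𝐐₂⟦" c ", " u "⟧" => (32 * c ^ (2 : ℕ) + 128 * c ^ (3 : ℕ) + 128 * c ^ (4 : ℕ) + 32 * c ^ (5 : ℕ) + 60 * c * u + 480 * c ^ (2 : ℕ) * u + 840 * c ^ (3 : ℕ) * u + 480 * c ^ (4 : ℕ) * u + 60 * c ^ (5 : ℕ) * u + 24 * u ^ (2 : ℕ) + 456 * c * u ^ (2 : ℕ) + 1440 * c ^ (2 : ℕ) * u ^ (2 : ℕ) + 1440 * c ^ (3 : ℕ) * u ^ (2 : ℕ) + 456 * c ^ (4 : ℕ) * u ^ (2 : ℕ) + 24 * c ^ (5 : ℕ) * u ^ (2 : ℕ) + 120 * u ^ (3 : ℕ) + 800 * c * u ^ (3 : ℕ) + 1360 * c ^ (2 : ℕ) * u ^ (3 : ℕ) + 800 * c ^ (3 : ℕ) * u ^ (3 : ℕ) + 120 * c ^ (4 : ℕ) * u ^ (3 : ℕ) + 120 * u ^ (4 : ℕ) + 360 * c * u ^ (4 : ℕ) + 360 * c ^ (2 : ℕ) * u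 ^ (4 : ℕ) + 120 * c ^ (3 : ℕ) * u ^ (4 : ℕ))

/-- The polynomial `𝐑₂(c,u)` of the certificate (explicit; local notation, no definition). -/
local notation3 (prettyPrint := false) "𝐑₂⟦" c ", " u "⟧" => (32 * c ^ (2 : ℕ) + 192 * c ^ (3 : ℕ) + 192 * c ^ (4 : ℕ) + 32 * c ^ (5 : ℕ) + 60 * c * u + 864 * c ^ (2 : ℕ) * u + 1992 * c ^ (3 : ℕ) * u + 864 * c ^ (4 : ℕ) * u + 60 * c ^ (5 : ℕ) * u + 24 * u ^ (2 : ℕ) + 936 * c * u ^ (2 : ℕ) + 4800 * c ^ (2 : ℕ) * u ^ (2 : ℕ) + 4800 * c ^ (3 : ℕ) * u ^ (2 : ℕ) + 936 * c ^ (4 : ℕ) * u ^ (2 : ℕ) + 24 * c ^ (5 : ℕ) * u ^ (2 : ℕ) + 280 * u ^ (3 : ℕ) + 3680 * c * u ^ (3 : ℕ) + 8080 * c ^ (2 : ℕ) * u ^ (3 : ℕ) + 3680 * c ^ (3 : ℕ) * u ^ (3 : ℕ) + 280 * c ^ (4 : ℕ) * u ^ (3 : ℕ) + 840 * u ^ (4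 : ℕ) + 4440 * c * u ^ (4 : ℕ) + 4440 * c ^ (2 : ℕ) * u ^ (4 : ℕ) + 840 * c ^ (3 : ℕ) * u ^ (4 : ℕ) + 672 * u ^ (5 : ℕ) + 1344 * c * u ^ (5 : ℕ) + 672 * c ^ (2 : ℕ) * u ^ (5 : ℕ))

/-! ## 1. The generic extended-Chebyshev step (three functions, two Rolle steps) -/

/-- **GENERIC ECT STEP.**  Let `p, q, r` be real functions with derivatives `p₁, q₁, r₁` on `(0,∞)`, themselves with derivatives `p₂, q₂, r₂`
there; assume `p > 0`, `W(p,q) = pq₁ − p₁q > 0` and `W(p,q,r) > 0` on `(0,∞)`.  Then no combination `x·p + y·q + z·r` with `z ≠ 0` has three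
distinct zeros `0 < ρ₁ < ρ₂ < ρ₃`.  (Divide by `p`, Rolle; divide by `W(p,q)`, Rolle; the universal identity
`(pr″ − p″r)(pq′ − p′q) − (pr′ − p′r)(pq″ − p″q) = p·W(p,q,r)`.) [folklore] -/
theorem ect_no_three_zeros (p q r p₁ q₁ r₁ p₂ q₂ r₂ : ℝ → ℝ)
    (hp : ∀ v, 0 < v → HasDerivAt p (p₁ v) v) (hq : ∀ v, 0 < v → HasDerivAt q (q₁ v) v) (hr : ∀ v, 0 < v → HasDerivAt r (r₁ v) v)
    (hp₁ : ∀ v, 0 < v → HasDerivAt p₁ (p₂ v) v) (hq₁ : ∀ v, 0 < v → HasDerivAt q₁ (q₂ v) v)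
    (hr₁ : ∀ v, 0 < v → HasDerivAt r₁ (r₂ v) v)
    (pos_p : ∀ v, 0 < v → 0 < p v) (pos_W₂ : ∀ v, 0 < v → 0 < p v * q₁ v - p₁ v * q v)
    (pos_W₃ : ∀ v, 0 < v →
      0 < p v * (q₁ v * r₂ v - r₁ v * q₂ v) - q v * (p₁ v * r₂ v - r₁ v * p₂ v) + r v * (p₁ v * q₂ v - q₁ v * p₂ v))
    (x y z : ℝ) (hz : z ≠ 0) {ρ₁ ρ₂ ρ₃ : ℝ} (h₁ : 0 < ρ₁) (h₁₂ : ρ₁ < ρ₂) (h₂₃ : ρ₂ < ρ₃)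
    (e₁ : x * p ρ₁ + y * q ρ₁ + z * r ρ₁ = 0) (e₂ : x * p ρ₂ + y * q ρ₂ + z * r ρ₂ = 0) (e₃ : x * p ρ₃ + y * q ρ₃ + z * r ρ₃ = 0) :
    False := by
  have h₂ : 0 < ρ₂ := h₁.trans h₁₂
  have h₃ : 0 < ρ₃ := h₂.trans h₂₃
  -- first quotient F = f/p and its derivative
  set F : ℝ → ℝ := fun v => (x * p v + y * q v + z * r v) / p v with hF
  set F' : ℝ → ℝ := fun v => (y * (p v * q₁ v - p₁ v * q v) + z * (p v * r₁ v - p₁ v * r v)) / p v ^ 2 with hF'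
  have hFder : ∀ v, 0 < v → HasDerivAt F (F' v) v := by
    intro v hv
    have hP := pos_p v hv
    have hnum := (((hp v hv).const_mul x).fun_add ((hq v hv).const_mul y)).fun_add ((hr v hv).const_mul z)
    have h := hnum.fun_div (hp v hv) hP.ne'
    refine h.congr_deriv ?_
    rw [hF']
    field_simp
    ring
  have hF0 : ∀ v, 0 < v → x * p v + y * q v + z * r v = 0 → F v = 0 := by
    intro v hv e; simp only [hF, e, zero_div]
  have rolle : ∀ α β, 0 < α → α < β → F α = 0 → F β = 0 → ∃ σ ∈ Ioo α β, F' σ = 0 := by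
    intro α β hα hαβ eα eβ
    have hcont : ContinuousOn F (Icc α β) := fun v hv => (hFder v (hα.trans_le hv.1)).continuousAt.continuousWithinAt
    exact exists_hasDerivAt_eq_zero hαβ hcont (eα.trans eβ.symm) (fun v hv => hFder v (hα.trans hv.1))
  obtain ⟨σ₁, hσ₁, hσ₁0⟩ := rolle ρ₁ ρ₂ h₁ h₁₂ (hF0 _ h₁ e₁) (hF0 _ h₂ e₂)
  obtain ⟨σ₂, hσ₂, hσ₂0⟩ := rolle ρ₂ ρ₃ h₂ h₂₃ (hF0 _ h₂ e₂) (hF0 _ h₃ e₃)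
  have hσ₁pos : 0 < σ₁ := h₁.trans hσ₁.1
  have hσ₂pos : 0 < σ₂ := h₂.trans hσ₂.1
  have hσσ : σ₁ < σ₂ := hσ₁.2.trans hσ₂.1
  have hG0 : ∀ σ, 0 < σ → F' σ = 0 → y * (p σ * q₁ σ - p₁ σ * q σ) + z * (p σ * r₁ σ - p₁ σ * r σ) = 0 := by
    intro σ hσ h0
    have hP := pos_p σ hσ
    rw [hF', div_eq_zero_iff] at h0
    rcases h0 with h0 | h0
    · exact h0
    · exact absurd h0 (pow_ne_zero 2 hP.ne')
  -- second quotient G = ψ/W(p,q) and its derivative z·p·W₃/W₂²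
  set G : ℝ → ℝ := fun v => (y * (p v * q₁ v - p₁ v * q v) + z * (p v * r₁ v - p₁ v * r v)) / (p v * q₁ v - p₁ v * q v) with hG
  set G' : ℝ → ℝ := fun v => z * (p v * (p v * (q₁ v * r₂ v - r₁ v * q₂ v) - q v * (p₁ v * r₂ v - r₁ v * p₂ v)
      + r v * (p₁ v * q₂ v - q₁ v * p₂ v))) / (p v * q₁ v - p₁ v * q v) ^ 2 with hG'
  have hW₂der : ∀ v, 0 < v → HasDerivAt (fun w => p w * q₁ w - p₁ w * q w) (p v * q₂ v - p₂ v * q v) v := by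
    intro v hv
    have h := ((hp v hv).fun_mul (hq₁ v hv)).fun_sub ((hp₁ v hv).fun_mul (hq v hv))
    exact h.congr_deriv (by ring)
  have hWder : ∀ v, 0 < v → HasDerivAt (fun w => p w * r₁ w - p₁ w * r w) (p v * r₂ v - p₂ v * r v) v := by
    intro v hv
    have h := ((hp v hv).fun_mul (hr₁ v hv)).fun_sub ((hp₁ v hv).fun_mul (hr v hv))
    exact h.congr_deriv (by ring)
  have hGder : ∀ v, 0 < v → HasDerivAt G (G' v) v := by
    intro v hv
    have hW := pos_W₂ v hv
    have hnum := ((hW₂der v hv).const_mul y).fun_add ((hWder v hv).const_mul z)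
    have h := hnum.fun_div (hW₂der v hv) hW.ne'
    refine h.congr_deriv ?_
    rw [hG', div_left_inj' (pow_ne_zero 2 hW.ne')]
    ring
  have hGz : ∀ σ, 0 < σ → F' σ = 0 → G σ = 0 := by
    intro σ hσ h0; simp only [hG, hG0 σ hσ h0, zero_div]
  have hcontG : ContinuousOn G (Icc σ₁ σ₂) := fun v hv => (hGder v (hσ₁pos.trans_le hv.1)).continuousAt.continuousWithinAt
  obtain ⟨τ, hτ, hτ0⟩ := exists_hasDerivAt_eq_zero hσσ hcontG ((hGz σ₁ hσ₁pos hσ₁0).trans (hGz σ₂ hσ₂pos hσ₂0).symm)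
    (fun v hv => hGder v (hσ₁pos.trans hv.1))
  have hτpos : 0 < τ := hσ₁pos.trans hτ.1
  have hP := pos_p τ hτpos
  have hW₂ := pos_W₂ τ hτpos
  have hW₃ := pos_W₃ τ hτpos
  rw [hG', div_eq_zero_iff] at hτ0
  rcases hτ0 with h0 | h0
  · rcases mul_eq_zero.1 h0 with h0 | h0
    · exact hz h0
    · rcases mul_eq_zero.1 h0 with h0 | h0
      · exact absurd h0 hP.ne'
      · exact absurd h0 hW₃.ne'
  · exact absurd h0 (pow_ne_zero 2 hW₂.ne')

/-! ## 2. The certificate's polynomials: no three zeros -/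

/-- **THE CHEBYSHEV STEP FOR `(P, Q, R)`.**  For `c > 0` and `z ≠ 0`, `x·P + y·Q + z·R` has no three distinct zeros `0 < ρ₁ < ρ₂ < ρ₃`; in
particular (with `x = b₁b₂`, `y = −a(b₁+b₂)`, `z = a²`) the numerator of `H′` in `…ParallelTwoCertificate.num_identity` has at most two
positive zeros. [this file] -/
theorem no_three_zeros {c : ℝ} (hc : 0 < c) (x y z : ℝ) (hz : z ≠ 0) {ρ₁ ρ₂ ρ₃ : ℝ} (h₁ : 0 < ρ₁) (h₁₂ : ρ₁ < ρ₂) (h₂₃ : ρ₂ < ρ₃)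
    (e₁ : x * 𝐏⟦c, ρ₁⟧ + y * 𝐐⟦c, ρ₁⟧ + z * 𝐑⟦c, ρ₁⟧ = 0) (e₂ : x * 𝐏⟦c, ρ₂⟧ + y * 𝐐⟦c, ρ₂⟧ + z * 𝐑⟦c, ρ₂⟧ = 0)
    (e₃ : x * 𝐏⟦c, ρ₃⟧ + y * 𝐐⟦c, ρ₃⟧ + z * 𝐑⟦c, ρ₃⟧ = 0) : False :=
  ect_no_three_zeros (fun v => 𝐏⟦c, v⟧) (fun v => 𝐐⟦c, v⟧) (fun v => 𝐑⟦c, v⟧) (fun v => 𝐏₁⟦c, v⟧) (fun v => 𝐐₁⟦c, v⟧)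
    (fun v => 𝐑₁⟦c, v⟧) (fun v => 𝐏₂⟦c, v⟧) (fun v => 𝐐₂⟦c, v⟧) (fun v => 𝐑₂⟦c, v⟧)
    (fun v _ => hasDerivAt_P c v) (fun v _ => hasDerivAt_Q c v) (fun v _ => hasDerivAt_R c v)
    (fun v _ => hasDerivAt_P₁ c v) (fun v _ => hasDerivAt_Q₁ c v) (fun v _ => hasDerivAt_R₁ c v)
    (fun _ hv => P_pos hc hv) (fun _ hv => wronskian₂_pos hc hv) (fun _ hv => wronskian₃_pos hc hv)
    x y z hz h₁ h₁₂ h₂₃ e₁ e₂ e₃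

end Summit.ValiantsHypothesis.ValiantsHypothesis.Theorems.LacunarySymmetroidMatrixDescartes.Pivot.CriticalWindows.ParallelTwo
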